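import Summits.ABC.ABC.Theorems.TowerFourSubLiouville.Negative.FixedFormsDirichlet

/-!
# `TowerFourSubLiouville` (stmt-ABC-1649): the two-exponent enemy diagram of the uniform core

The open core of the crux (line `fourth-radical-binomial-thue`, stub `stub_genericFormsSaving`, crux-equivalent by
p87895) is the DIAGONAL `θ = φ = η` of the two-exponent uniform binomial quartic saving

  `UBQ₂(θ, φ)`:  `∃ Z₀, ∀ v w Y Z ≥ Z₀` (positive, `gcd(vY, wZ) = 1`, `wZ⁴ ≠ vY⁴`):
                 `max(v,w) ≤ Z^θ  ⟹  |wZ⁴ − vY⁴| > Z^φ`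

(coefficient exponent `θ`, saving exponent `φ`; `UBQ η = UBQ₂(η, η)` is the hypothesis of the landed `stub_transfer`).
This file (standing disprover, cycle 5, refuter-cdisprove-stmt-ABC-1649-g5-0) assembles the PROVED part of the
`(θ, φ)` diagram in one place, each corner being an explicit enemy family already in the tree:

* `not_ubq₂_corner_two_one`:   `UBQ₂(θ, φ)` fails for `θ > 2, φ > 1`   — `padeFamily₁` (`[2/2]` Padé of `(1+1/t)⁴`:
  coefficients `≤ 4Z²`, value `2Z + 1`; `Negative.UniformSavingCeiling.exists_padeFamily₁`);
* `not_ubq₂_corner_one_threeHalves`: fails for `θ > 1, φ > 3/2` — `padeFamily₂` (coefficients `≤ 27Z`,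
  value `≤ 8000 Z^{3/2}`; `exists_padeFamily₂`); on the diagonal this is the ceiling `η ≤ 3/2` (p106450);
* `not_ubq₂_corner_zero_two`:  fails for `θ > 0, φ > 2`   — Dirichlet for `⁴√2` on the two fixed forms `(1,2)`, `(8,1)`
  (`Negative.FixedFormsDirichlet.fixedForms_false_above_two`, p125878);
* `not_ubq₂_corner_three_zero`: fails for `θ > 3, φ ≥ 0` — the `z = 1` Bezout/Padé identity of shape `(3,3,0)`
  (`bezoutFamily₃_identity`: `(20s³+130s²+284s+209)(s+1)⁴ = (20s³+50s²+44s+13)(s+2)⁴ + 1`, value EXACTLY `1` at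
  coefficient height `≤ 209 Z³`; coprimality is automatic from the value `1`) — sharpens the Bezout witness
  `(Z⁴+1, 1, 1, Z)` of `ubq_false_without_height` from height `Z⁴` to `Z³`;
* `ubq₂_false_of_corner`: the union of the first three quadrants; `ubq₂_false_of_corner₄`: all four.

The diagram for the provers (what is PROVED vs CONJECTURED):
```
  φ (saving)
  2 ┼───────────●(0,2)························   above φ = 2: FALSE for every θ > 0 (Dirichlet)
    │ TRUE on     ╲  conjectural boundary θ+φ = 2 (pairs ≤ Z^θ, residue ≍ v¼w¾Z³: expected
    │ every fixed  ╲   violators at height Z ≍ Z^{θ+φ−3}, summable iff θ+φ < 2)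
3/2 ┤ box (Roth,    ●(1,3/2)━━━━━━━━━━━━━━━━━━━   right of θ = 1 and above φ = 3/2: FALSE (padeFamily₂)
    │ p85914)        ╲
  1 ┤                 ╲        ●(2,1)━━━━━━━━━━━   right of θ = 2 and above φ = 1: FALSE (padeFamily₁)
    │   ABC ⟹ TRUE    ╲
    │   (9/4)θ + φ < 2  ╲  (abc on vY⁴ + k = wZ⁴; diagonal: every η < 8/13, skeleton `AbcGivesUBQ`)
  0 ┼────┬────┬────┬────╲────┬────●(3,0)━━━━━━   right of θ = 3, every φ ≥ 0: FALSE (value 1, bezoutFamily₃)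
    0   1/2   1   3/2   2        3             θ (coefficient height)
```
All four corners lie on the Mason–Stothers lines `θ + φ = 2 + 1/z` of their parameter degree (`z = 1`: `(3,0)`,
`(2,1)`; `z = 2`: `(1, 3/2)`; and `(0,2)` is the Dirichlet/Roth vertical) — the tight (Belyi) identities of
`Negative.PolynomialEnemyFloor`; the `z = 2` tight shape `(3,3,2)` (corner `(3/2, 1)`) exists only over a cubic field
and `z = 3` shapes (corners `(1, 4/3)`, `(4/3, 1)`) only over fields of degree `> 6` (disprover census, cycles 4–5).
Identity enemies can only add corners ON OR ABOVE `θ + φ = 2 + 1/z` (ℙ¹, `Negative.PolynomialEnemyFloor`) resp.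
`θ + φ = 2` (torus, `Negative.TorusEnemyFloor`); the crux needs one point `(η, η)`, `η > 0`, of the TRUE region,
and nothing proved separates `(1/100, 1/100)` from `(0.99, 0.99)`.
-/

-- `Summit.ABC.ABC` is the mandated summit-side namespace (CONVENTIONS §2); the duplicate is deliberate.
set_option linter.dupNamespace false

namespace Summit.ABC.ABC.Theorems.TowerFourSubLiouville.Negative

/-- Growth bookkeeping: for real exponents `a < b` and any constant `c`, `c · Z^a ≤ Z^b` for all large naturals `Z`. -/
theorem eventually_const_mul_rpow_le (c a b : ℝ) (hab : a < b) :
    ∃ N : ℕ, ∀ Z : ℕ, N ≤ Z → c * (Z : ℝ) ^ a ≤ (Z : ℝ) ^ b := by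
  rcases le_or_gt c 0 with hc | hc
  · refine ⟨1, fun Z _ => ?_⟩
    have h1 : (0 : ℝ) ≤ (Z : ℝ) ^ a := Real.rpow_nonneg (by positivity) _
    have h2 : (0 : ℝ) ≤ (Z : ℝ) ^ b := Real.rpow_nonneg (by positivity) _
    nlinarith
  · have hba : 0 < b - a := by linarith
    obtain ⟨N₁, hN₁⟩ := exists_nat_ge (c ^ (1 / (b - a)))
    refine ⟨max N₁ 1, fun Z hZ => ?_⟩
    have hZ1 : (1 : ℝ) ≤ Z := by exact_mod_cast le_trans (le_max_right _ _) hZ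
    have hZ0 : (0 : ℝ) < Z := by linarith
    have hcZ : c ≤ (Z : ℝ) ^ (b - a) := by
      have hN₁Z : c ^ (1 / (b - a)) ≤ Z := le_trans hN₁ (by exact_mod_cast le_trans (le_max_left _ _) hZ)
      calc c = (c ^ (1 / (b - a))) ^ (b - a) := by
            rw [← Real.rpow_mul hc.le, one_div_mul_cancel hba.ne', Real.rpow_one]
        _ ≤ (Z : ℝ) ^ (b - a) := Real.rpow_le_rpow (Real.rpow_nonneg hc.le _) hN₁Z hba.le
    have hsplit : (Z : ℝ) ^ b = (Z : ℝ) ^ (b - a) * (Z : ℝ) ^ a := by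
      rw [← Real.rpow_add hZ0]; ring_nf
    rw [hsplit]
    exact mul_le_mul_of_nonneg_right hcZ (Real.rpow_nonneg hZ0.le _)

/-- **Corner `(2, 1)`: `UBQ₂(θ, φ)` fails for `θ > 2`, `φ > 1`** — the degree-1 Padé family has coefficients
`≤ 4Z²` and value exactly `2Z + 1`. -/
theorem not_ubq₂_corner_two_one (θ φ : ℝ) (hθ : 2 < θ) (hφ : 1 < φ) :
    ¬ ∃ Z₀ : ℕ, ∀ v w Y Z : ℕ, Z₀ ≤ Z → 0 < v → 0 < w → 0 < Y → Nat.Coprime (v * Y) (w * Z) →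
      ((max v w : ℕ) : ℝ) ≤ (Z : ℝ) ^ θ → w * Z ^ 4 ≠ v * Y ^ 4 →
      (Z : ℝ) ^ φ < |((w * Z ^ 4 : ℕ) : ℝ) - ((v * Y ^ 4 : ℕ) : ℝ)| := by
  rintro ⟨Z₀, h⟩
  obtain ⟨N₁, hN₁⟩ := eventually_const_mul_rpow_le 4 2 θ hθ
  obtain ⟨N₂, hN₂⟩ := eventually_const_mul_rpow_le 3 1 φ hφ
  obtain ⟨v, w, Y, Z, hNZ, hv, hw, hY, hZ, hcop, hid, hvw, hw4⟩ :=
    exists_padeFamily₁ (max (max Z₀ N₁) N₂)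
  have hZ₀ : Z₀ ≤ Z := le_trans (le_trans (le_max_left _ _) (le_max_left _ _)) hNZ
  have h1 := hN₁ Z (le_trans (le_trans (le_max_right _ _) (le_max_left _ _)) hNZ)
  have h2 := hN₂ Z (le_trans (le_max_right _ _) hNZ)
  have hZR : (0 : ℝ) < Z := by exact_mod_cast hZ
  rw [show ((Z : ℝ) ^ (2 : ℝ)) = (Z : ℝ) ^ (2 : ℕ) from by rw [← Real.rpow_natCast]; norm_num] at h1
  rw [Real.rpow_one] at h2
  have hmax : ((max v w : ℕ) : ℝ) ≤ (Z : ℝ) ^ θ := by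
    rw [max_eq_right hvw]
    have : (w : ℝ) ≤ 4 * (Z : ℝ) ^ 2 := by exact_mod_cast hw4
    linarith
  have hne : w * Z ^ 4 ≠ v * Y ^ 4 := by rw [hid]; omega
  have key := h v w Y Z hZ₀ hv hw hY hcop hmax hne
  have habs : |((w * Z ^ 4 : ℕ) : ℝ) - ((v * Y ^ 4 : ℕ) : ℝ)| = 2 * Z + 1 := by
    rw [hid]; push_cast
    rw [show ((w : ℝ) * (Z : ℝ) ^ 4 - ((w : ℝ) * (Z : ℝ) ^ 4 + (2 * Z + 1))) = -(2 * (Z : ℝ) + 1) by ring,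
      abs_neg, abs_of_nonneg (by positivity)]
  rw [habs] at key
  have hZ1 : (1 : ℝ) ≤ Z := by exact_mod_cast hZ
  linarith

/-- **Corner `(1, 3/2)`: `UBQ₂(θ, φ)` fails for `θ > 1`, `φ > 3/2`** — the degree-2 Padé family has coefficients
`≤ 27Z` and value `a` with `a² ≤ 64·10⁶ Z³`.  (Diagonal case `θ = φ`: `not_ubq_of_three_halves_lt`, p106450.) -/
theorem not_ubq₂_corner_one_threeHalves (θ φ : ℝ) (hθ : 1 < θ) (hφ : 3 / 2 < φ) :
    ¬ ∃ Z₀ : ℕ, ∀ v w Y Z : ℕ, Z₀ ≤ Z → 0 < v → 0 < w → 0 < Y → Nat.Coprime (v * Y) (w * Z) →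
      ((max v w : ℕ) : ℝ) ≤ (Z : ℝ) ^ θ → w * Z ^ 4 ≠ v * Y ^ 4 →
      (Z : ℝ) ^ φ < |((w * Z ^ 4 : ℕ) : ℝ) - ((v * Y ^ 4 : ℕ) : ℝ)| := by
  rintro ⟨Z₀, h⟩
  obtain ⟨N₁, hN₁⟩ := eventually_const_mul_rpow_le 27 1 θ hθ
  obtain ⟨N₂, hN₂⟩ := eventually_const_mul_rpow_le 64000001 3 (2 * φ) (by linarith)
  obtain ⟨v, w, Y, Z, a, hNZ, h3, hv, hw, hY, ha, hcop, hid, hvw, hw27, ha2⟩ :=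
    exists_padeFamily₂ (max (max Z₀ N₁) N₂)
  have hZ₀ : Z₀ ≤ Z := le_trans (le_trans (le_max_left _ _) (le_max_left _ _)) hNZ
  have h1 := hN₁ Z (le_trans (le_trans (le_max_right _ _) (le_max_left _ _)) hNZ)
  have h2 := hN₂ Z (le_trans (le_max_right _ _) hNZ)
  have hZR : (0 : ℝ) < Z := by exact_mod_cast (show 0 < Z by omega)
  rw [Real.rpow_one] at h1
  rw [show ((Z : ℝ) ^ (3 : ℝ)) = (Z : ℝ) ^ (3 : ℕ) from by rw [← Real.rpow_natCast]; norm_num] at h2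
  have hmax : ((max v w : ℕ) : ℝ) ≤ (Z : ℝ) ^ θ := by
    rw [max_eq_right hvw]
    have : (w : ℝ) ≤ 27 * Z := by exact_mod_cast hw27
    linarith
  have hne : w * Z ^ 4 ≠ v * Y ^ 4 := by rw [hid]; omega
  have key := h v w Y Z hZ₀ hv hw hY hcop hmax hne
  have habs : |((w * Z ^ 4 : ℕ) : ℝ) - ((v * Y ^ 4 : ℕ) : ℝ)| = a := by
    rw [hid]; push_cast
    rw [show ((w : ℝ) * (Z : ℝ) ^ 4 - ((w : ℝ) * (Z : ℝ) ^ 4 + a)) = -(a : ℝ) by ring, abs_neg,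
      abs_of_nonneg (by positivity)]
  rw [habs] at key
  -- a² ≤ 64e6 Z³ < 64000001 Z³ ≤ Z^{2φ} = (Z^φ)²
  have ha2R : (a : ℝ) ^ 2 ≤ 64000000 * (Z : ℝ) ^ 3 := by exact_mod_cast ha2
  have hZ3 : (0 : ℝ) < (Z : ℝ) ^ 3 := by positivity
  have hsq : (Z : ℝ) ^ (2 * φ) = ((Z : ℝ) ^ φ) ^ 2 := by
    rw [mul_comm, Real.rpow_mul hZR.le]; norm_num
  have hlt : (a : ℝ) ^ 2 < ((Z : ℝ) ^ φ) ^ 2 := by rw [← hsq]; linarith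
  have hZφ : (0 : ℝ) ≤ (Z : ℝ) ^ φ := Real.rpow_nonneg hZR.le _
  have : (a : ℝ) < (Z : ℝ) ^ φ := lt_of_pow_lt_pow_left₀ 2 hZφ hlt
  linarith

/-- **Corner `(0, 2)`: `UBQ₂(θ, φ)` fails for `θ > 0`, `φ > 2`** — the two fixed forms `(1,2)`, `(8,1)` of
`fixedForms_false_above_two` have coefficients `≤ 8 ≤ Z^θ` eventually, so a threshold for `UBQ₂(θ, φ)` would be a
threshold for the box `H = 8` at the saving `φ > 2`, which Dirichlet forbids. -/
theorem not_ubq₂_corner_zero_two (θ φ : ℝ) (hθ : 0 < θ) (hφ : 2 < φ) :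
    ¬ ∃ Z₀ : ℕ, ∀ v w Y Z : ℕ, Z₀ ≤ Z → 0 < v → 0 < w → 0 < Y → Nat.Coprime (v * Y) (w * Z) →
      ((max v w : ℕ) : ℝ) ≤ (Z : ℝ) ^ θ → w * Z ^ 4 ≠ v * Y ^ 4 →
      (Z : ℝ) ^ φ < |((w * Z ^ 4 : ℕ) : ℝ) - ((v * Y ^ 4 : ℕ) : ℝ)| := by
  rintro ⟨Z₀, h⟩
  obtain ⟨N₁, hN₁⟩ := eventually_const_mul_rpow_le 8 0 θ hθ
  refine fixedForms_false_above_two φ hφ 8 le_rfl ⟨max Z₀ N₁, fun v w Y Z hZ hbox hv hw hY hcop _ hne => ?_⟩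
  have h1 := hN₁ Z (le_trans (le_max_right _ _) hZ)
  rw [Real.rpow_zero, mul_one] at h1
  have hmax : ((max v w : ℕ) : ℝ) ≤ (Z : ℝ) ^ θ := le_trans (by exact_mod_cast hbox) h1
  exact h v w Y Z (le_trans (le_max_left _ _) hZ) hv hw hY hcop hmax hne

/-- **The proved FALSE region of the `(θ, φ)` diagram**: the union of the three quadrants. -/
theorem ubq₂_false_of_corner {θ φ : ℝ}
    (hc : (2 < θ ∧ 1 < φ) ∨ (1 < θ ∧ 3 / 2 < φ) ∨ (0 < θ ∧ 2 < φ)) :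
    ¬ ∃ Z₀ : ℕ, ∀ v w Y Z : ℕ, Z₀ ≤ Z → 0 < v → 0 < w → 0 < Y → Nat.Coprime (v * Y) (w * Z) →
      ((max v w : ℕ) : ℝ) ≤ (Z : ℝ) ^ θ → w * Z ^ 4 ≠ v * Y ^ 4 →
      (Z : ℝ) ^ φ < |((w * Z ^ 4 : ℕ) : ℝ) - ((v * Y ^ 4 : ℕ) : ℝ)| := by
  rcases hc with ⟨hθ, hφ⟩ | ⟨hθ, hφ⟩ | ⟨hθ, hφ⟩
  · exact not_ubq₂_corner_two_one θ φ hθ hφ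
  · exact not_ubq₂_corner_one_threeHalves θ φ hθ hφ
  · exact not_ubq₂_corner_zero_two θ φ hθ hφ

/-- On the diagonal the diagram gives back exactly the known ceiling: `UBQ η` fails for every `η > 3/2`
(and says nothing below). -/
example (η : ℝ) (hη : 3 / 2 < η) :
    ¬ ∃ Z₀ : ℕ, ∀ v w Y Z : ℕ, Z₀ ≤ Z → 0 < v → 0 < w → 0 < Y → Nat.Coprime (v * Y) (w * Z) →
      ((max v w : ℕ) : ℝ) ≤ (Z : ℝ) ^ η → w * Z ^ 4 ≠ v * Y ^ 4 →
      (Z : ℝ) ^ η < |((w * Z ^ 4 : ℕ) : ℝ) - ((v * Y ^ 4 : ℕ) : ℝ)| :=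
  ubq₂_false_of_corner (Or.inr (Or.inl ⟨by linarith, hη⟩))

/-- **The `z = 1` Bezout/Padé identity of shape `(3,3,0)`**: value exactly `1` at cubic coefficient height
(`V = (1+x)^{-4} mod x⁴` at `x = 1/t`, shifted to `t = s + 1` so that all coefficients are positive). -/
theorem bezoutFamily₃_identity (s : ℕ) :
    (20 * s ^ 3 + 130 * s ^ 2 + 284 * s + 209) * (s + 1) ^ 4 =
      (20 * s ^ 3 + 50 * s ^ 2 + 44 * s + 13) * (s + 2) ^ 4 + 1 := by
  ring

/-- The `(3,3,0)` family packaged: beyond every height a coprime quadruple with `vY⁴ = wZ⁴ + 1`,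
`v, w ≤ 209 Z³` (coprimality `gcd(vY, wZ) = 1` is forced by the value `1`: `Y³·(vY) − Z³·(wZ) = 1`). -/
theorem exists_bezoutFamily₃ (N : ℕ) : ∃ v w Y Z : ℕ, N ≤ Z ∧ 0 < v ∧ 0 < w ∧ 0 < Y ∧ 1 ≤ Z ∧
    Nat.Coprime (v * Y) (w * Z) ∧ v * Y ^ 4 = w * Z ^ 4 + 1 ∧ w ≤ v ∧ v ≤ 209 * Z ^ 3 := by
  refine ⟨20 * N ^ 3 + 130 * N ^ 2 + 284 * N + 209, 20 * N ^ 3 + 50 * N ^ 2 + 44 * N + 13, N + 1, N + 2,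
    by omega, by positivity, by positivity, Nat.succ_pos N, by omega, ?_, bezoutFamily₃_identity N, by nlinarith,
    Nat.le.intro (k := 189 * N ^ 3 + 1124 * N ^ 2 + 2224 * N + 1463) (by ring)⟩
  exact coprime_of_int_combination (a := ((N : ℤ) + 1) ^ 3) (b := -(((N : ℤ) + 2) ^ 3)) (r := 1)
    (by push_cast; ring) (Nat.coprime_one_left _)

/-- **Corner `(3, 0)`: `UBQ₂(θ, φ)` fails for `θ > 3` and EVERY `φ ≥ 0`** — the value can be exactly `1` at cubic
coefficient height. -/
theorem not_ubq₂_corner_three_zero (θ φ : ℝ) (hθ : 3 < θ) (hφ : 0 ≤ φ) :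
    ¬ ∃ Z₀ : ℕ, ∀ v w Y Z : ℕ, Z₀ ≤ Z → 0 < v → 0 < w → 0 < Y → Nat.Coprime (v * Y) (w * Z) →
      ((max v w : ℕ) : ℝ) ≤ (Z : ℝ) ^ θ → w * Z ^ 4 ≠ v * Y ^ 4 →
      (Z : ℝ) ^ φ < |((w * Z ^ 4 : ℕ) : ℝ) - ((v * Y ^ 4 : ℕ) : ℝ)| := by
  rintro ⟨Z₀, h⟩
  obtain ⟨N₁, hN₁⟩ := eventually_const_mul_rpow_le 209 3 θ hθ
  obtain ⟨v, w, Y, Z, hNZ, hv, hw, hY, hZ1, hcop, hid, hwv, hv209⟩ := exists_bezoutFamily₃ (max Z₀ N₁)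
  have hZ₀ : Z₀ ≤ Z := le_trans (le_max_left _ _) hNZ
  have h1 := hN₁ Z (le_trans (le_max_right _ _) hNZ)
  rw [show ((Z : ℝ) ^ (3 : ℝ)) = (Z : ℝ) ^ (3 : ℕ) from by rw [← Real.rpow_natCast]; norm_num] at h1
  have hmax : ((max v w : ℕ) : ℝ) ≤ (Z : ℝ) ^ θ := by
    rw [max_eq_left hwv]
    have : (v : ℝ) ≤ 209 * (Z : ℝ) ^ 3 := by exact_mod_cast hv209
    linarith
  have hne : w * Z ^ 4 ≠ v * Y ^ 4 := by rw [hid]; omega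
  have key := h v w Y Z hZ₀ hv hw hY hcop hmax hne
  have habs : |((w * Z ^ 4 : ℕ) : ℝ) - ((v * Y ^ 4 : ℕ) : ℝ)| = 1 := by
    rw [hid]; push_cast
    rw [show ((w : ℝ) * (Z : ℝ) ^ 4 - ((w : ℝ) * (Z : ℝ) ^ 4 + 1)) = -1 by ring]
    norm_num
  rw [habs] at key
  have hZR : (1 : ℝ) ≤ Z := by exact_mod_cast hZ1
  have : (1 : ℝ) ≤ (Z : ℝ) ^ φ := Real.one_le_rpow hZR hφ
  linarith

/-- **The proved FALSE region, all four corners.** -/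
theorem ubq₂_false_of_corner₄ {θ φ : ℝ}
    (hc : (3 < θ ∧ 0 ≤ φ) ∨ (2 < θ ∧ 1 < φ) ∨ (1 < θ ∧ 3 / 2 < φ) ∨ (0 < θ ∧ 2 < φ)) :
    ¬ ∃ Z₀ : ℕ, ∀ v w Y Z : ℕ, Z₀ ≤ Z → 0 < v → 0 < w → 0 < Y → Nat.Coprime (v * Y) (w * Z) →
      ((max v w : ℕ) : ℝ) ≤ (Z : ℝ) ^ θ → w * Z ^ 4 ≠ v * Y ^ 4 →
      (Z : ℝ) ^ φ < |((w * Z ^ 4 : ℕ) : ℝ) - ((v * Y ^ 4 : ℕ) : ℝ)| := by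
  rcases hc with ⟨hθ, hφ⟩ | hc
  · exact not_ubq₂_corner_three_zero θ φ hθ hφ
  · exact ubq₂_false_of_corner hc

end Summit.ABC.ABC.Theorems.TowerFourSubLiouville.Negative
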